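import Literature.NumberTheory.QuadraticFields.EpsteinZetaFifteenSublattices
import Literature.NumberTheory.QuadraticFields.ChowlaSelbergFifteenSum
import Literature.NumberTheory.QuadraticFields.TwistedDedekindZeta
import Literature.NumberTheory.QuadraticFields.GenusCharacterValues
import HarnessLib

/-!
# Chowla–Selberg at `D = −15`, II: the genus character — `Z₁ − Z₂ = 2 L(s, χ₋₃) L(s, χ₅)`
# and the difference of the two Kronecker-limit constants

Topic `NumberTheory/QuadraticFields`, namespace
`Literature.NumberTheory.QuadraticFields.ChowlaSelbergFifteen` (sequel of
`ChowlaSelbergFifteenSum.lean` and `EpsteinZetaFifteenSublattices.lean`). Everything here is PROVED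
(theorems only; no definitions, no named facts).

The class group of `ℚ(√−15)` has order `2`; its non-trivial character is Gauss's genus character,
whose `L`-function factors as `L(s, χ₋₃) L(s, χ₅)` (Siegel, *Advanced Analytic Number Theory*,
Ch. II §5; Zagier, *Zetafunktionen und quadratische Körper*, §12). We do not build the genus
character; instead we twist the Dedekind zeta function by the Dirichlet character `χ₅ = (·/5)`:

* `twistZeta_neg_snd`, `tsum_twist_eq_half_sum_twistZeta` — for any imaginary quadratic field with
  `d_K < −4` and any Dirichlet character `ψ`:
  **`Σ_𝔞 ψ(N𝔞) N𝔞^{−s} = ½ Σ_{Q reduced} Σ'_{(x,y)} ψ(Q(x,y)) Q(x,y)^{−s}`** (`Re s > 1`), the twisted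
  form of the tree's `dedekindZeta_eq_half_sum_epsteinZeta` (same proof, class by class through
  `tsum_ideal_mul_isPrincipal_eq_half_twistZeta`);
* `twistZeta_chi₅_Q₁`, `twistZeta_chi₅_Q₂` — by Gauss's lemma (tree `legendreSym_formValue_eq`:
  the values of `Q₁ = x² + xy + 4y²` prime to `5` are residues, those of `Q₂ = 2x² + xy + 2y²`
  non-residues mod `5`) and the sublattice identities of `EpsteinZetaFifteenSublattices.lean`:
  `Σ' χ₅(Q₁)Q₁^{−s} = Z₁ − 5^{−s}Z₂`, `Σ' χ₅(Q₂)Q₂^{−s} = −(Z₂ − 5^{−s}Z₁)`;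
* `LSeries_chi₅_mul_chi₁₅` — `Σ χ₅(n)χ₋₁₅(n) n^{−s} = (1 + 5^{−s}) L(s, χ₋₃)` (the character
  `χ₅χ₋₁₅` is `χ₋₃` made imprimitive at `5`; Mathlib `LFunction_changeLevel`);
* `epsteinZeta_sub_eq` — **`Z₁(s) − Z₂(s) = 2 L(s, χ₋₃) L(s, χ₅)`** for real `s > 1`, from the
  tree's `Σ_𝔞 ψ(N𝔞)N𝔞^{−s} = L(s,ψ) L(s, ψχ_{d_K})` (`tsum_twist_eq_LSeries_mul_LSeries`) with `ψ = χ₅`;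
* `kroneckerConstant_sub` — **`C₁ − C₂ = 2 L(1, χ₋₃) L(1, χ₅)`** for the Kronecker-limit constants
  of `ChowlaSelbergFifteenSum.lean` (the right side is regular at `s = 1`).

## References

* C. L. Siegel, *Advanced Analytic Number Theory*, TIFR / Springer (1980), Ch. II §5 (genus
  characters and `L(s, χ₁)L(s, χ₂)`).
* D. B. Zagier, *Zetafunktionen und quadratische Körper*, Springer (1981), §12.
* [Cox2013] D. A. Cox, *Primes of the form x² + ny²*, 2nd ed. (2013), §3.B Lemma 3.13, Thm. 3.15
  (genus theory of discriminant `−15`), §7.B Thm. 7.7.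
* [BorweinBorwein1987] J. M. Borwein, P. B. Borwein, *Pi and the AGM* (1987), §9.2.
-/

noncomputable section

open Complex Filter Topology Module NumberField Ideal
open Literature.Barriers.RiemannHypothesis
open Literature.NumberTheory.QuadraticFields.Quadratic
open Literature.NumberTheory.QuadraticFields.BakerLimitFormula (twistZeta twistTerm hasSum_twistZeta
  summable_norm_twistTerm)
open Literature.NumberTheory.QuadraticFields.KroneckerLimit
open Literature.NumberTheory.QuadraticFields.BinaryQuadraticForm (reducedForms mem_reducedForms_iff)
open Literature.NumberTheory.EllipticCurves (two_mul_ediv_two_of_disc_eq norm_eq_of_disc_eq)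
open scoped nonZeroDivisors NumberTheorySymbols

namespace Literature.NumberTheory.QuadraticFields.ChowlaSelbergFifteen

/-! ### Twisted Epstein sums: the flip `y ↦ −y` -/

/-- The twisted Epstein sum of `(a, −b, c)` is that of `(a, b, c)` with the weight flipped in `y`
(substitute `y ↦ −y`). [folklore] -/
theorem twistZeta_neg_snd (w : ℤ × ℤ → ℂ) (a b c : ℝ) (s : ℂ) :
    twistZeta w a (-b) c s = twistZeta (fun p : ℤ × ℤ => w (p.1, -p.2)) a b c s := by
  unfold twistZeta
  rw [← (Equiv.prodCongr (Equiv.refl ℤ) (Equiv.neg ℤ)).tsum_eq (twistTerm w a (-b) c s)]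
  refine tsum_congr fun p => ?_
  obtain ⟨x, y⟩ := p
  simp only [Equiv.prodCongr_apply, Equiv.coe_refl, Prod.map_apply, id_eq, Equiv.neg_apply,
    twistTerm, epsteinTerm]
  have h0 : ((x, -y) : ℤ × ℤ) = 0 ↔ ((x, y) : ℤ × ℤ) = 0 := by simp [Prod.ext_iff]
  by_cases hp : ((x, y) : ℤ × ℤ) = 0
  · rw [if_pos (h0.2 hp), if_pos hp]
  · rw [if_neg (fun h => hp (h0.1 h)), if_neg hp]
    congr 3
    unfold bqfEval
    push_cast
    ring

/-! ### The twisted class decomposition for an imaginary quadratic field -/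

section Field

variable {K : Type*} [Field K] [NumberField K]

/-- **The class sum of a reduced form, twisted**: for `Q = (A, B, C)` reduced of discriminant
`t² + 4m = d_K < −4`, a Dirichlet character `ψ` and `Re s > 1`,
`Σ_{𝔞 : 𝔞_Q 𝔞 principal} ψ(N𝔞) N𝔞^{−s} = ½ Σ'_{(x,y)} ψ(Q(x,y)) Q(x,y)^{−s}`
(`tsum_ideal_mul_isPrincipal_eq_half_twistZeta` gives the opposite form `(A, −B, C)`; flip `y ↦ −y`).
[cite: Cox2013, §7.B Thm. 7.7] -/
theorem tsum_ideal_twist_eq_half_twistZeta (b : Basis (Fin 2) ℤ (𝓞 K)) (hb : b 0 = 1)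
    {t m : ℤ} (hω : b 1 * b 1 = (m : 𝓞 K) + (t : 𝓞 K) * b 1) (hD : t ^ 2 + 4 * m < -4)
    {Q : ℤ × ℤ × ℤ} (hQ : Q ∈ reducedForms (t ^ 2 + 4 * m)) {N : ℕ} [NeZero N]
    (ψ : DirichletCharacter ℂ N) {s : ℂ} (hs : 1 < s.re) :
    ∑' J : {J : Ideal (𝓞 K) //
        (span {(Q.1 : 𝓞 K), b 1 - (((Q.2.1 + t) / 2 : ℤ) : 𝓞 K)} * J).IsPrincipal},
        ψ (absNorm J.1) * ((absNorm J.1 : ℕ) : ℂ) ^ (-s) =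
      1 / 2 * twistZeta (fun p : ℤ × ℤ =>
          ψ ((Q.1 * p.1 ^ 2 + Q.2.1 * p.1 * p.2 + Q.2.2 * p.2 ^ 2 : ℤ) : ZMod N))
        (Q.1 : ℝ) (Q.2.1 : ℝ) (Q.2.2 : ℝ) s := by
  have hneg : t ^ 2 + 4 * m < 0 := by linarith
  obtain ⟨hdisc, hA, -, -⟩ := (mem_reducedForms_iff hneg).1 hQ
  have hd : Q.2.1 ^ 2 - 4 * Q.1 * Q.2.2 = t ^ 2 + 4 * m := hdisc
  set k : ℤ := (Q.2.1 + t) / 2 with hk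
  have h2k : 2 * k = Q.2.1 + t := two_mul_ediv_two_of_disc_eq hd
  have hn : Q.1 * Q.2.2 = k ^ 2 - t * k - m := norm_eq_of_disc_eq hd h2k
  have h := tsum_ideal_mul_isPrincipal_eq_half_twistZeta b hb hω hD hA hn ψ hs
  have hk' : t - 2 * k = -Q.2.1 := by linarith
  simp only [hk'] at h
  rw [h, show ((-Q.2.1 : ℤ) : ℝ) = -(Q.2.1 : ℝ) by push_cast; ring, twistZeta_neg_snd]
  congr 1
  unfold twistZeta
  refine tsum_congr fun p => ?_
  simp only [twistTerm]
  congr 3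
  ring

/-- **The twisted Dedekind zeta function class by class**: for an imaginary quadratic field `K`
with `d_K = t² + 4m < −4`, a Dirichlet character `ψ` and `Re s > 1`,
`Σ_𝔞 ψ(N𝔞) N𝔞^{−s} = ½ Σ_{Q ∈ reducedForms d_K} Σ'_{(x,y)} ψ(Q(x,y)) Q(x,y)^{−s}` — the ideals are
partitioned by classes, `[𝔞] = [𝔞_Q]⁻¹` for a unique reduced `Q` (`reducedForms_mk0_bijective`), and
each class sum is `tsum_ideal_twist_eq_half_twistZeta`. [cite: Cox2013, §7.B Thm. 7.7] -/
theorem tsum_twist_eq_half_sum_twistZeta (b : Basis (Fin 2) ℤ (𝓞 K)) (hb : b 0 = 1)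
    {t m : ℤ} (hω : b 1 * b 1 = (m : 𝓞 K) + (t : 𝓞 K) * b 1) (hD : t ^ 2 + 4 * m < -4)
    {N : ℕ} [NeZero N] (ψ : DirichletCharacter ℂ N) {s : ℂ} (hs : 1 < s.re) :
    ∑' I : Ideal (𝓞 K), ψ (absNorm I) * ((absNorm I : ℕ) : ℂ) ^ (-s) =
      1 / 2 * ∑ Q ∈ reducedForms (t ^ 2 + 4 * m), twistZeta (fun p : ℤ × ℤ =>
          ψ ((Q.1 * p.1 ^ 2 + Q.2.1 * p.1 * p.2 + Q.2.2 * p.2 ^ 2 : ℤ) : ZMod N))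
        (Q.1 : ℝ) (Q.2.1 : ℝ) (Q.2.2 : ℝ) s := by
  classical
  have hneg : t ^ 2 + 4 * m < 0 := by linarith
  have hs0 : -s ≠ 0 := neg_ne_zero.mpr fun h => by rw [h, Complex.zero_re] at hs; linarith
  set D := t ^ 2 + 4 * m with hDdef
  -- the ideal of a form and the summand
  set 𝔞 : ℤ × ℤ × ℤ → Ideal (𝓞 K) := fun Q =>
    span {(Q.1 : 𝓞 K), b 1 - (((Q.2.1 + t) / 2 : ℤ) : 𝓞 K)} with h𝔞
  set G : Ideal (𝓞 K) → ℂ := fun I => ψ (absNorm I) * ((absNorm I : ℕ) : ℂ) ^ (-s) with hG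
  have hGsum : Summable G := (summable_norm_twist K ψ hs).of_norm
  -- the bijection with the class group
  have hbij := reducedForms_mk0_bijective b hb hω hneg
  set Ψ : reducedForms D → _root_.ClassGroup (𝓞 K) := fun Q =>
    ClassGroup.mk0 ⟨_, formIdeal_mem_nonZeroDivisors b hb hneg Q⟩ with hΨ
  -- pointwise: `G I = Σ_Q [𝔞_Q I principal] G I`
  have hpt : ∀ I : Ideal (𝓞 K),
      G I = ∑ Q ∈ reducedForms D, Set.indicator {I | (𝔞 Q * I).IsPrincipal} G I := by
    intro I
    by_cases hI : I = ⊥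
    · have hG0 : G I = 0 := by
        rw [hG, hI]
        simp only [Ideal.absNorm_bot, Nat.cast_zero, Complex.zero_cpow hs0, mul_zero]
      rw [hG0]
      refine (Finset.sum_eq_zero fun Q _ => ?_).symm
      by_cases hmem : I ∈ {I | (𝔞 Q * I).IsPrincipal}
      · rw [Set.indicator_of_mem hmem, hG0]
      · rw [Set.indicator_of_notMem hmem]
    · have hI0 : I ∈ (Ideal (𝓞 K))⁰ := mem_nonZeroDivisors_of_ne_zero hI
      have hiff : ∀ Q : reducedForms D,
          (𝔞 Q * I).IsPrincipal ↔ Ψ Q = (ClassGroup.mk0 ⟨I, hI0⟩)⁻¹ := by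
        intro Q
        rw [hΨ, ClassGroup.mk0_eq_mk0_inv_iff, Submodule.isPrincipal_iff]
        simp only
        constructor
        · rintro ⟨x, hx⟩
          refine ⟨x, ?_, hx⟩
          rintro rfl
          rw [Submodule.span_zero_singleton] at hx
          exact (mul_ne_zero (nonZeroDivisors.ne_zero (formIdeal_mem_nonZeroDivisors b hb hneg Q)) hI) hx
        · rintro ⟨x, -, hx⟩
          exact ⟨x, hx⟩
      obtain ⟨Q₀, hQ₀, huniq⟩ : ∃! Q : reducedForms D, Ψ Q = (ClassGroup.mk0 ⟨I, hI0⟩)⁻¹ :=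
        (Function.bijective_iff_existsUnique Ψ).1 hbij _
      rw [Finset.sum_eq_single (Q₀ : ℤ × ℤ × ℤ)]
      · rw [Set.indicator_of_mem]
        exact (hiff Q₀).2 hQ₀
      · intro Q hQ hne
        rw [Set.indicator_of_notMem]
        intro hmem
        have h1 := (hiff ⟨Q, hQ⟩).1 hmem
        exact hne (congrArg Subtype.val (huniq ⟨Q, hQ⟩ h1))
      · intro h
        exact absurd Q₀.2 h
  -- sum over `I`, then interchange
  have hind : ∀ Q ∈ reducedForms D, Summable (Set.indicator {I | (𝔞 Q * I).IsPrincipal} G) :=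
    fun Q _ => hGsum.indicator _
  rw [tsum_congr hpt, Summable.tsum_finsetSum hind, Finset.mul_sum]
  refine Finset.sum_congr rfl fun Q hQ => ?_
  rw [← tsum_subtype, ← tsum_ideal_twist_eq_half_twistZeta b hb hω hD hQ ψ hs]
  rfl

/-- For `d_K = −15` and any Dirichlet character `ψ`:
`Σ_𝔞 ψ(N𝔞) N𝔞^{−s} = ½ (Σ' ψ(Q₁)Q₁^{−s} + Σ' ψ(Q₂)Q₂^{−s})` (`Re s > 1`). [cite: Cox2013, §7.B Thm. 7.7] -/
theorem tsum_twist_eq_half_add (h2 : finrank ℚ K = 2) (hd : NumberField.discr K = -15)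
    {N : ℕ} [NeZero N] (ψ : DirichletCharacter ℂ N) {s : ℂ} (hs : 1 < s.re) :
    ∑' I : Ideal (𝓞 K), ψ (absNorm I) * ((absNorm I : ℕ) : ℂ) ^ (-s) =
      1 / 2 * (twistZeta (fun p : ℤ × ℤ => ψ ((p.1 ^ 2 + p.1 * p.2 + 4 * p.2 ^ 2 : ℤ) : ZMod N)) 1 1 4 s +
        twistZeta (fun p : ℤ × ℤ => ψ ((2 * p.1 ^ 2 + p.1 * p.2 + 2 * p.2 ^ 2 : ℤ) : ZMod N)) 2 1 2 s) := by
  obtain ⟨b, hb⟩ := exists_basis_zero_eq_one h2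
  have hω := basis_one_mul_self_eq b hb
  have hDK := discr_eq_sq_add_four_mul b hb
  have h15 : (b.repr (b 1 * b 1) 1) ^ 2 + 4 * b.repr (b 1 * b 1) 0 = -15 := by rw [← hDK, hd]
  have hD : (b.repr (b 1 * b 1) 1) ^ 2 + 4 * b.repr (b 1 * b 1) 0 < -4 := by rw [h15]; norm_num
  rw [tsum_twist_eq_half_sum_twistZeta b hb hω hD ψ hs, h15, reducedForms_neg_fifteen,
    Finset.sum_pair (by decide)]
  push_cast
  ring_nf

end Field

/-! ### Gauss's lemma at `p = 5`: the twists by `χ₅` of `Z₁` and `Z₂` -/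

/-- **`χ₅(Q₁(x,y)) = 1` unless `5 ∣ Q₁(x,y)`** (Gauss: the values of `x² + xy + 4y²` prime to `5`
are quadratic residues, `4Q₁ = (2x+y)² + 15y²`). [cite: Cox2013, §3.B Lemma 3.13] -/
theorem jacobiChar_five_Q₁ (x y : ℤ) :
    jacobiChar 5 ((x ^ 2 + x * y + 4 * y ^ 2 : ℤ) : ZMod 5) =
      if (5 : ℤ) ∣ x ^ 2 + x * y + 4 * y ^ 2 then 0 else 1 := by
  haveI : Fact (Nat.Prime 5) := ⟨Nat.prime_five⟩
  rw [jacobiChar_intCast, ← jacobiSym.legendreSym.to_jacobiSym]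
  split_ifs with h
  · rw [(legendreSym.eq_zero_iff 5 _).mpr ((ZMod.intCast_zmod_eq_zero_iff_dvd _ 5).mpr h), Int.cast_zero]
  · have hv := legendreSym_formValue_eq (p := 5) (by norm_num) (A := 1) (B := 1) (C := 4)
      (by rw [BinaryQuadraticForm.isPrimitive_iff]; rfl) (by norm_num) x y
      (by simpa [one_mul] using h)
    simp only [one_mul] at hv
    rw [hv, formGenusValue, if_neg (by norm_num), legendreSym.at_one, Int.cast_one]

/-- **`χ₅(Q₂(x,y)) = −1` unless `5 ∣ Q₂(x,y)`** (the values of `2x² + xy + 2y²` prime to `5` are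
non-residues: `8Q₂ = (4x+y)² + 15y²`, `(2/5) = −1`). [cite: Cox2013, §3.B Lemma 3.13] -/
theorem jacobiChar_five_Q₂ (x y : ℤ) :
    jacobiChar 5 ((2 * x ^ 2 + x * y + 2 * y ^ 2 : ℤ) : ZMod 5) =
      if (5 : ℤ) ∣ 2 * x ^ 2 + x * y + 2 * y ^ 2 then 0 else -1 := by
  haveI : Fact (Nat.Prime 5) := ⟨Nat.prime_five⟩
  have legendreSym_five_two : legendreSym 5 2 = -1 := by
    rw [legendreSym.at_two (by norm_num)]
    decide
  rw [jacobiChar_intCast, ← jacobiSym.legendreSym.to_jacobiSym]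
  split_ifs with h
  · rw [(legendreSym.eq_zero_iff 5 _).mpr ((ZMod.intCast_zmod_eq_zero_iff_dvd _ 5).mpr h), Int.cast_zero]
  · have hv := legendreSym_formValue_eq (p := 5) (by norm_num) (A := 2) (B := 1) (C := 2)
      (by rw [BinaryQuadraticForm.isPrimitive_iff]; rfl) (by norm_num) x y
      (by simpa [one_mul] using h)
    simp only [one_mul] at hv
    rw [hv, formGenusValue, if_neg (by norm_num), legendreSym_five_two]
    push_cast
    ring

/-- **`Σ' χ₅(Q₁) Q₁^{−s} = Z₁(s) − 5^{−s} Z₂(s)`** for `Re s > 1`: the weight kills the terms with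
`5 ∣ Q₁`, which sum to `5^{−s}Z₂` (`tsum_dvd_five_Q₁`). [cite: Cox2013, §3.B Thm. 3.15] -/
theorem twistZeta_chi₅_Q₁ {s : ℂ} (hs : 1 < s.re) :
    twistZeta (fun p : ℤ × ℤ => jacobiChar 5 ((p.1 ^ 2 + p.1 * p.2 + 4 * p.2 ^ 2 : ℤ) : ZMod 5)) 1 1 4 s =
      epsteinZeta 1 1 4 s - (5 : ℂ) ^ (-s) * epsteinZeta 2 1 2 s := by
  have hsum : Summable (epsteinTerm 1 1 4 s) := (summable_norm_epsteinTerm isPosDefForm_Q₁ hs).of_norm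
  have hind := hsum.indicator {p : ℤ × ℤ | (5 : ℤ) ∣ p.1 ^ 2 + p.1 * p.2 + 4 * p.2 ^ 2}
  rw [← tsum_dvd_five_Q₁ s, epsteinZeta, ← hsum.tsum_sub hind, twistZeta]
  refine tsum_congr fun p => ?_
  rw [twistTerm, jacobiChar_five_Q₁]
  simp only [Set.indicator_apply, Set.mem_setOf_eq]
  split_ifs <;> ring

/-- **`Σ' χ₅(Q₂) Q₂^{−s} = −(Z₂(s) − 5^{−s} Z₁(s))`** for `Re s > 1` (`tsum_dvd_five_Q₂`).
[cite: Cox2013, §3.B Thm. 3.15] -/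
theorem twistZeta_chi₅_Q₂ {s : ℂ} (hs : 1 < s.re) :
    twistZeta (fun p : ℤ × ℤ => jacobiChar 5 ((2 * p.1 ^ 2 + p.1 * p.2 + 2 * p.2 ^ 2 : ℤ) : ZMod 5)) 2 1 2 s =
      -(epsteinZeta 2 1 2 s - (5 : ℂ) ^ (-s) * epsteinZeta 1 1 4 s) := by
  have hsum : Summable (epsteinTerm 2 1 2 s) := (summable_norm_epsteinTerm isPosDefForm_Q₂ hs).of_norm
  have hind := hsum.indicator {p : ℤ × ℤ | (5 : ℤ) ∣ 2 * p.1 ^ 2 + p.1 * p.2 + 2 * p.2 ^ 2}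
  rw [← tsum_dvd_five_Q₂ s, epsteinZeta, ← hsum.tsum_sub hind, ← tsum_neg, twistZeta]
  refine tsum_congr fun p => ?_
  rw [twistTerm, jacobiChar_five_Q₂]
  simp only [Set.indicator_apply, Set.mem_setOf_eq]
  split_ifs <;> ring

/-! ### The `L`-function side: `χ₅ χ₋₁₅` is `χ₋₃` made imprimitive at `5` -/

/-- **`χ₅(n) χ₋₁₅(n) = χ₋₃'(n)`** with `χ₋₃'` the character `(·/3)` modulo `15`
(`J(n|15) = J(n|3)J(n|5)`, `J(n|5)² = 1` for `5 ∤ n`). [folklore] -/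
theorem jacobiChar_five_mul_fifteen (n : ℕ) :
    jacobiChar 5 n * jacobiChar 15 n =
      DirichletCharacter.changeLevel (by norm_num : (3 : ℕ) ∣ 15) (jacobiChar 3) (n : ZMod 15) := by
  by_cases hu : IsUnit (n : ZMod 15)
  · -- `n` coprime to `15`
    have hcop : n.Coprime 15 := (ZMod.isUnit_iff_coprime n 15).mp hu
    have h5 : n.Coprime 5 := Nat.Coprime.coprime_dvd_right (by norm_num) hcop
    obtain ⟨u, hu'⟩ := hu
    rw [← hu', DirichletCharacter.changeLevel_eq_cast_of_dvd, hu', ZMod.cast_natCast (by norm_num : 3 ∣ 15),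
      jacobiChar_natCast, jacobiChar_natCast, jacobiChar_natCast,
      show ((15 : ℕ) : ℕ) = 3 * 5 by rfl, jacobiSym.mul_right' (n : ℤ) (by norm_num) (by norm_num)]
    have hsq : J((n : ℤ) | 5) ^ 2 = 1 := by
      apply jacobiSym.sq_one
      rw [Int.gcd_natCast_natCast]
      exact h5
    push_cast
    linear_combination (J((n : ℤ) | 3) : ℂ) * (by exact_mod_cast hsq : (J((n : ℤ) | 5) : ℂ) ^ 2 = 1)
  · -- `gcd(n, 15) ≠ 1`: both sides vanish
    rw [MulChar.map_nonunit (DirichletCharacter.changeLevel (by norm_num : (3 : ℕ) ∣ 15) (jacobiChar 3)) hu,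
      MulChar.map_nonunit (jacobiChar 15) hu, mul_zero]

/-- **`Σ χ₅(n) χ₋₁₅(n) n^{−s} = (1 + 5^{−s}) L(s, χ₋₃)`** for `Re s > 1`
(Mathlib's `LFunction_changeLevel`: `χ₋₃(3) = 0`, `χ₋₃(5) = −1`). [folklore] -/
theorem LSeries_chi₅_mul_chi₁₅ {s : ℂ} (hs : 1 < s.re) :
    LSeries (fun n => jacobiChar 5 n * jacobiChar 15 n) s =
      (1 + (5 : ℂ) ^ (-s)) * (jacobiChar 3).LFunction s := by
  have hs1 : s ≠ 1 := fun h => by rw [h, Complex.one_re] at hs; exact lt_irrefl _ hs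
  set χ' := DirichletCharacter.changeLevel (by norm_num : (3 : ℕ) ∣ 15) (jacobiChar 3) with hχ'
  have hL : LSeries (fun n => jacobiChar 5 n * jacobiChar 15 n) s = χ'.LFunction s := by
    rw [DirichletCharacter.LFunction_eq_LSeries χ' hs]
    exact LSeries_congr (fun {n} _ => jacobiChar_five_mul_fifteen n) s
  rw [hL, hχ', DirichletCharacter.LFunction_changeLevel _ _ (Or.inr hs1),
    show (15 : ℕ).primeFactors = {3, 5} by
      rw [show (15 : ℕ) = 3 * 5 by norm_num, Nat.primeFactors_mul (by norm_num) (by norm_num),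
        Nat.prime_three.primeFactors, Nat.prime_five.primeFactors]
      decide, Finset.prod_pair (by norm_num)]
  have h3 : jacobiChar 3 ((3 : ℕ) : ZMod 3) = 0 :=
    jacobiChar_natCast_eq_zero_of_dvd (dvd_refl 3) (by norm_num)
  have h5 : jacobiChar 3 ((5 : ℕ) : ZMod 3) = -1 := by
    have hZ : J(((5 : ℕ) : ℤ) | 3) = -1 := by norm_num
    rw [jacobiChar_natCast, hZ]
    push_cast
    ring
  push_cast at h3 h5 ⊢
  rw [h3, h5]
  ring

/-! ### `Z₁ − Z₂ = 2 L(s, χ₋₃) L(s, χ₅)` -/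

/-- **`Z₁(s) − Z₂(s) = 2 L(s, χ₋₃) L(s, χ₅)` for `Re s > 1`**: twist the Dedekind zeta function
of `ℚ(√−15)` by `χ₅` — class by class this is `½((Z₁ − 5^{−s}Z₂) − (Z₂ − 5^{−s}Z₁))
= ½(1 + 5^{−s})(Z₁ − Z₂)` (Gauss's lemma), and by Euler products it is
`L(s, χ₅) · (1 + 5^{−s}) L(s, χ₋₃)`. [cite: Cox2013, §3.B Thm. 3.15] -/
theorem epsteinZeta_sub_eq {s : ℂ} (hs : 1 < s.re) :
    epsteinZeta 1 1 4 s - epsteinZeta 2 1 2 s =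
      2 * ((jacobiChar 3).LFunction s * (jacobiChar 5).LFunction s) := by
  obtain ⟨K, _, _, h2, hd⟩ := exists_quadraticField_neg_fifteen
  have hodd : Odd (NumberField.discr K) := by rw [hd]; decide
  haveI : NeZero (NumberField.discr K).natAbs := neZero_natAbs_discr
  have h15 : (NumberField.discr K).natAbs = 15 := by rw [hd]; rfl
  -- class side
  have hcl := tsum_twist_eq_half_add h2 hd (jacobiChar 5) hs
  rw [twistZeta_chi₅_Q₁ hs, twistZeta_chi₅_Q₂ hs] at hcl
  -- `L` side
  have hL := tsum_twist_eq_LSeries_mul_LSeries h2 hodd (jacobiChar 5) hs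
  have hcongr : ∀ (M : ℕ) [NeZero M], M = 15 → ∀ n : ℕ, jacobiChar M n = jacobiChar 15 n := by
    intro M _ hM n; subst hM; rfl
  have hL' : LSeries (fun n => jacobiChar 5 n * jacobiChar (NumberField.discr K).natAbs n) s =
      LSeries (fun n => jacobiChar 5 n * jacobiChar 15 n) s :=
    LSeries_congr (fun {n} _ => by rw [hcongr _ h15 n]) s
  rw [hL', LSeries_chi₅_mul_chi₁₅ hs, ← DirichletCharacter.LFunction_eq_LSeries _ hs] at hL
  rw [hcl] at hL
  -- cancel `1 + 5^{−s} ≠ 0`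
  have h5 : (1 : ℂ) + (5 : ℂ) ^ (-s) ≠ 0 := by
    intro h0
    have hnorm : ‖(5 : ℂ) ^ (-s)‖ < 1 := by
      rw [show (5 : ℂ) = ((5 : ℕ) : ℂ) by norm_num, Complex.norm_natCast_cpow_of_pos (by norm_num),
        Complex.neg_re]
      exact Real.rpow_lt_one_of_one_lt_of_neg (by norm_num) (by linarith)
    have : (5 : ℂ) ^ (-s) = -1 := by linear_combination h0
    rw [this, norm_neg, norm_one] at hnorm
    exact lt_irrefl _ hnorm
  have key : (1 + (5 : ℂ) ^ (-s)) * (epsteinZeta 1 1 4 s - epsteinZeta 2 1 2 s -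
      2 * ((jacobiChar 3).LFunction s * (jacobiChar 5).LFunction s)) = 0 := by
    linear_combination 2 * hL
  have := (mul_eq_zero.mp key).resolve_left h5
  linear_combination this

/-- **`C₁ − C₂ = 2 L(1, χ₋₃) L(1, χ₅)`**: the difference of the Kronecker-limit constants of
`Q₁`, `Q₂` (the poles cancel) is the value at `s = 1` of `Z₁ − Z₂ = 2L(s,χ₋₃)L(s,χ₅)`.
[cite: BorweinBorwein1987, §9.2] -/
theorem kroneckerConstant_sub :
    ((2 * Real.pi / Real.sqrt 15 * (2 * Real.eulerMascheroniConstant - Real.log 15 -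
        4 * Real.log ‖ModularForm.eta (rootPoint 1 1 4)‖) : ℝ) : ℂ) -
      ((2 * Real.pi / Real.sqrt 15 * (2 * Real.eulerMascheroniConstant - Real.log (15 / 2) -
        4 * Real.log ‖ModularForm.eta (rootPoint 2 1 2)‖) : ℝ) : ℂ) =
      2 * ((jacobiChar 3).LFunction 1 * (jacobiChar 5).LFunction 1) := by
  -- Epstein side: the difference of the two convergent expressions
  have hE := tendsto_Z₁.sub tendsto_Z₂
  have hE' : Tendsto (fun s : ℝ => epsteinZeta 1 1 4 s - epsteinZeta 2 1 2 s) (𝓝[>] 1)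
      (𝓝 (((2 * Real.pi / Real.sqrt 15 * (2 * Real.eulerMascheroniConstant - Real.log 15 -
        4 * Real.log ‖ModularForm.eta (rootPoint 1 1 4)‖) : ℝ) : ℂ) -
      ((2 * Real.pi / Real.sqrt 15 * (2 * Real.eulerMascheroniConstant - Real.log (15 / 2) -
        4 * Real.log ‖ModularForm.eta (rootPoint 2 1 2)‖) : ℝ) : ℂ))) := by
    refine hE.congr fun s => ?_
    ring
  -- L side: continuity at `1`
  have h3 : jacobiChar 3 ≠ 1 := jacobiChar_ne_one (by decide) Nat.prime_three.squarefree (by norm_num)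
  have h5 : jacobiChar 5 ≠ 1 := jacobiChar_ne_one (by decide) Nat.prime_five.squarefree (by norm_num)
  have hc : Continuous fun s : ℂ => 2 * ((jacobiChar 3).LFunction s * (jacobiChar 5).LFunction s) :=
    continuous_const.mul ((DirichletCharacter.differentiable_LFunction h3).continuous.mul
      (DirichletCharacter.differentiable_LFunction h5).continuous)
  have hL : Tendsto (fun s : ℝ => epsteinZeta 1 1 4 s - epsteinZeta 2 1 2 s) (𝓝[>] 1)
      (𝓝 (2 * ((jacobiChar 3).LFunction 1 * (jacobiChar 5).LFunction 1))) := by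
    have ht := (hc.tendsto (1 : ℂ)).comp
      ((Complex.continuous_ofReal.tendsto (1 : ℝ)).mono_left (nhdsWithin_le_nhds (s := Set.Ioi 1)))
    refine ht.congr' ?_
    filter_upwards [self_mem_nhdsWithin] with s hs
    have hs' : 1 < (s : ℂ).re := by simpa using hs
    simp only [Function.comp_apply]
    rw [epsteinZeta_sub_eq hs']
  exact tendsto_nhds_unique hE' hL

end Literature.NumberTheory.QuadraticFields.ChowlaSelbergFifteen
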